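import Literature.NumberTheory.IwasawaTheory.ClassicalMuVanishesNormRelationTowerCyclotomic
import Literature.NumberTheory.NumberFields.NormRelationKleinFour
import Mathlib.FieldTheory.Galois.Abelian
import HarnessLib

set_option autoImplicit false

/-!
# μ-descent through a Klein four-group: `μ(L^{⟨u⟩}) = μ(L^{⟨v⟩}) = μ(L^{⟨uv⟩}) = 0 ⇒ μ(L) = 0` for commuting involutions
# `u ≠ v` of `Gal(L/F)`, `p` odd — with no displayed certificate; invariance of `μ = 0` under `F`-isomorphism and
# conjugation; abelian fixed fields (the Ferrero–Washington input by name)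

Topic `NumberTheory/IwasawaTheory` (namespace = path).  THEOREM-ONLY file (no definition, no named fact, no `sorry`),
written by the literature seat `bsd-potss-conjA-anchor` g11 (cell `bsd-potss`; supports stmt-BirchSwinnertonDyer-19386 /
19413; closes nothing).  It specialises the μ-descent `classicalMuVanishes_restrict_of_normRelation`
(`ClassicalMuVanishesNormRelationTower.lean`) to the KERNEL-CERTIFIED Klein-four relation
`2 = N_⟨u⟩ + N_⟨v⟩ − u N_⟨uv⟩` ([BiasseEtAl2022] Example 2.5; tree `NormRelation.normRelation_klein_four`), and supplies the
bookkeeping a census row needs to feed the subfield inputs BY NAME: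

* `classicalMuVanishes_restrict_of_klein_four` — `F` a number field, `κ` a `ℤ_p`-extension of `F` with `p ≠ 2`, `L/F` finite
  Galois with `κ ∘ res` onto, `u, v ∈ Gal(L/F)` commuting involutions, `u ≠ v`, `u, v ≠ 1`:
  `μ(κ|_{L^{⟨u⟩}}) = μ(κ|_{L^{⟨v⟩}}) = μ(κ|_{L^{⟨uv⟩}}) = 0 ⇒ μ(κ|_L) = 0` (growth form `ClassicalMuVanishes`; under the growth fact
  `iwasawa1959_classNumberPExp_growth`).
* `classNumberPExp_restrict_eq_of_algEquiv`, `classicalMuVanishes_restrict_iff_of_algEquiv` — `e_n` and `μ = 0` of the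
  restricted tower `E·F_∞/E` depend on `E` only up to `F`-isomorphism (both layers are `j(E)·F_n ⊆ F̄` for an embedding `j`,
  `ZpExtension.natCard_classGroup_layer_restrict_eq`).
* `map_fixedField_eq_fixedField_map_conj`, `nonempty_algEquiv_fixedField_conj` — `g(L^H) = L^{gHg⁻¹}`, so conjugate subgroups
  have `F`-isomorphic fixed fields (Artin; [MilneFT2022] Ch. 3, the Galois correspondence is `G`-equivariant).
* `isAbelianGalois_fixedField_of_commutator_mem` — if `H ⊴ Gal(L/F)` contains all commutators then `L^H/F` is abelian
  (`Gal(L^H/F) ≅ Gal(L/F)/H`); with `F = ℚ` this is the hypothesis of `ferreroWashington1979_classicalMuVanishes`.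
* `classicalMuVanishes_of_isCyclotomic_of_klein_four` — consumer form: `κ` cyclotomic, `p ≠ 2`, `p ∤ [L : F]`, `u, v` as above
  with `uv` CONJUGATE to `v` in `Gal(L/F)`; inputs «`μ = 0` for every cyclotomic `ℤ_p`-extension» of `L^{⟨u⟩}` and of `L^{⟨v⟩}`
  ⇒ the same for `L`.
* `classicalMuVanishes_of_isCyclotomic_of_klein_four_rat` — over `F = ℚ` with `⟨u⟩ ⊇ [G, G]`: the `L^{⟨u⟩}`-input is
  DISCHARGED by the Ferrero–Washington fact (hypothesis `ferreroWashington1979_classicalMuVanishes`), leaving ONE subfield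
  input `L^{⟨v⟩}`.  Census reading (cell `bsd-potss`, `p = 3`): for `L = ℚ(E[3])` with `Gal(L/ℚ) ≅ N_s(3) ≅ D₄` take
  `u = −1`, `v = s` a reflection fixing a point `P` of order `3` (`−s = r s r⁻¹`, `[D₄, D₄] = {±1}`): **`μ(ℚ(E[3])) = 0 ⟸
  μ(ℚ(P)) = 0`** modulo FW + Iwasawa growth, by name; for `N_ns(3) ≅ SD₁₆` apply `…_of_klein_four` twice (`u = −1`, `v = s`:
  supports `ℚ(P)` and `ℚ(x(E[3])) = L^{±1}`, a `D₄`-octic handled by the `_rat` form with support `ℚ(x(P))`).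

References: [BiasseEtAl2022] Example 2.5, Prop. 3.7; [Washington1997] §13.1; [MilneFT2022] Ch. 3 (fundamental theorem of
Galois theory, conjugate subgroups ↔ conjugate intermediate fields); [Lang1990] Ch. 5 §1 Thm. 1.2 (iii).
-/

noncomputable section

open scoped NumberField

open Field IntermediateField Literature.NumberTheory.GaloisRepresentations Literature.NumberTheory.EllipticCurves
  Literature.NumberTheory.EllipticCurves.ZpExtension Literature.NumberTheory.NumberFields

namespace Literature.NumberTheory.IwasawaTheory

variable {F : Type} [Field F] [NumberField F] {p : ℕ} [Fact p.Prime]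

/-! ### §1 `μ = 0` of `E·F_∞/E` is invariant under `F`-isomorphisms of `E`; conjugate subgroups -/

/-- **`e_n(E·F_∞/E) = e_n(E'·F_∞/E')` for `F`-isomorphic `E ≃ₐ[F] E'`**: both `n`-th layers are ring-isomorphic to
`j(E')·F_n ⊆ F̄` for an embedding `j : E' → F̄` (and `j ∘ φ : E → F̄`), `ZpExtension.natCard_classGroup_layer_restrict_eq`.
[cite: Washington1997, §13.1] -/
theorem classNumberPExp_restrict_eq_of_algEquiv (κ : ZpExtension F p) {E E' : Type} [Field E] [NumberField E]
    [Algebra F E] [Field E'] [NumberField E'] [Algebra F E'] (φ : E ≃ₐ[F] E')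
    (hE : Function.Surjective (κ.toContinuousMonoidHom.comp (absGaloisRestrict F E)))
    (hE' : Function.Surjective (κ.toContinuousMonoidHom.comp (absGaloisRestrict F E'))) (n : ℕ) :
    classNumberPExp (κ.restrict E hE) n = classNumberPExp (κ.restrict E' hE') n := by
  haveI : FiniteDimensional F E' := Module.Finite.of_restrictScalars_finite ℚ F E'
  set j : E' →ₐ[F] AlgebraicClosure F := absEmbedding F E'
  have hrange : (j.comp (φ : E →ₐ[F] E')).fieldRange = j.fieldRange := by
    ext y
    simp only [AlgHom.mem_fieldRange, AlgHom.coe_comp, Function.comp_apply]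
    constructor
    · rintro ⟨x, rfl⟩
      exact ⟨φ x, rfl⟩
    · rintro ⟨x', rfl⟩
      exact ⟨φ.symm x', congrArg j (φ.apply_symm_apply x')⟩
  rw [classNumberPExp_def, classNumberPExp_def, natCard_classGroup_layer_restrict_eq κ E hE (j.comp φ) n,
    natCard_classGroup_layer_restrict_eq κ E' hE' j n, hrange]

/-- Hence `μ = 0` (growth form) for `E·F_∞/E` iff for `E'·F_∞/E'`, `E ≃ₐ[F] E'`. [cite: Washington1997, §13.1]
[cite: RaySujatha2021, §1 eq. (1.1)] -/
theorem classicalMuVanishes_restrict_iff_of_algEquiv (κ : ZpExtension F p) {E E' : Type} [Field E] [NumberField E]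
    [Algebra F E] [Field E'] [NumberField E'] [Algebra F E'] (φ : E ≃ₐ[F] E')
    (hE : Function.Surjective (κ.toContinuousMonoidHom.comp (absGaloisRestrict F E)))
    (hE' : Function.Surjective (κ.toContinuousMonoidHom.comp (absGaloisRestrict F E'))) :
    ClassicalMuVanishes (κ.restrict E hE) ↔ ClassicalMuVanishes (κ.restrict E' hE') := by
  simp only [ClassicalMuVanishes, classNumberPExp_restrict_eq_of_algEquiv κ φ hE hE']

omit [NumberField F] in
/-- **`g(L^H) = L^{gHg⁻¹}`**: an automorphism `g ∈ Gal(L/F)` maps the fixed field of `H` onto the fixed field of the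
conjugate subgroup. [cite: MilneFT2022, Ch. 3 (fundamental theorem: `σ(L^H) = L^{σHσ⁻¹}`)] -/
theorem map_fixedField_eq_fixedField_map_conj {L : Type} [Field L] [Algebra F L] (H : Subgroup (L ≃ₐ[F] L))
    (g : L ≃ₐ[F] L) :
    (fixedField H).map (g : L →ₐ[F] L) = fixedField (H.map (MulAut.conj g).toMonoidHom) := by
  ext y
  rw [IntermediateField.mem_map, IntermediateField.mem_fixedField_iff]
  constructor
  · rintro ⟨x, hx, rfl⟩ f hf
    rw [Subgroup.mem_map] at hf
    obtain ⟨h, hh, rfl⟩ := hf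
    rw [IntermediateField.mem_fixedField_iff] at hx
    change (g * h * g⁻¹) (g x) = g x
    rw [AlgEquiv.mul_apply, AlgEquiv.mul_apply, ← AlgEquiv.mul_apply g⁻¹ g, inv_mul_cancel, AlgEquiv.one_apply,
      hx h hh]
  · intro hy
    refine ⟨g⁻¹ y, ?_, ?_⟩
    · rw [IntermediateField.mem_fixedField_iff]
      intro h hh
      have key := hy (g * h * g⁻¹) (Subgroup.mem_map.mpr ⟨h, hh, rfl⟩)
      rw [AlgEquiv.mul_apply, AlgEquiv.mul_apply] at key
      calc h (g⁻¹ y) = g⁻¹ (g (h (g⁻¹ y))) := by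
            rw [← AlgEquiv.mul_apply g⁻¹ g, inv_mul_cancel, AlgEquiv.one_apply]
        _ = g⁻¹ y := by rw [key]
    · change g (g⁻¹ y) = y
      rw [← AlgEquiv.mul_apply, mul_inv_cancel, AlgEquiv.one_apply]

omit [NumberField F] in
/-- Conjugate subgroups have `F`-isomorphic fixed fields: `L^H ≃ₐ[F] L^{gHg⁻¹}` (restriction of `g`).
[cite: MilneFT2022, Ch. 3 (fundamental theorem: `σ(L^H) = L^{σHσ⁻¹}`)] -/
theorem nonempty_algEquiv_fixedField_conj {L : Type} [Field L] [Algebra F L] (H : Subgroup (L ≃ₐ[F] L))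
    (g : L ≃ₐ[F] L) :
    Nonempty (↥(fixedField H) ≃ₐ[F] ↥(fixedField (H.map (MulAut.conj g).toMonoidHom))) :=
  ⟨(IntermediateField.equivMap (fixedField H) (g : L →ₐ[F] L)).trans
    (IntermediateField.equivOfEq (map_fixedField_eq_fixedField_map_conj H g))⟩

omit [NumberField F] in
/-- **`L^H/F` is abelian when `H ⊴ Gal(L/F)` contains the commutators**: `Gal(L^H/F) ≅ Gal(L/F)/H` is commutative.
With `F = ℚ` this makes `L^H` an abelian number field, the hypothesis `IsAbelianGalois ℚ (L^H)` of the Ferrero–Washington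
fact `ferreroWashington1979_classicalMuVanishes`. [cite: MilneFT2022, Ch. 3 (fundamental theorem:
`Gal(L^H/F) ≅ G/H` for `H` normal)] [cite: Washington1997, §7.5 (Ferrero–Washington for abelian fields)] -/
theorem isAbelianGalois_fixedField_of_commutator_mem {L : Type} [Field L] [Algebra F L] [FiniteDimensional F L]
    [IsGalois F L] (H : Subgroup (L ≃ₐ[F] L)) [H.Normal]
    (hcomm : ∀ a b : L ≃ₐ[F] L, a * b * a⁻¹ * b⁻¹ ∈ H) : IsAbelianGalois F ↥(fixedField H) := by
  haveI : IsGalois F ↥(fixedField H) := IsGalois.of_fixedField_normal_subgroup H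
  have hker : ∀ c : L ≃ₐ[F] L, c ∈ H → AlgEquiv.restrictNormalHom ↥(fixedField H) c = 1 := by
    intro c hc
    rw [← MonoidHom.mem_ker, IntermediateField.restrictNormalHom_ker, IntermediateField.fixingSubgroup_fixedField]
    exact hc
  exact
    { is_comm := ⟨fun x y => by
        obtain ⟨a, rfl⟩ := AlgEquiv.restrictNormalHom_surjective L x
        obtain ⟨b, rfl⟩ := AlgEquiv.restrictNormalHom_surjective L y
        have h1 := hker _ (hcomm a b)
        rw [map_mul, map_mul, map_mul, map_inv, map_inv, mul_inv_eq_one, mul_inv_eq_iff_eq_mul] at h1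
        exact h1⟩ }

/-! ### §2 μ-descent through a Klein four-group -/

omit [NumberField F] [Fact p.Prime] in
/-- `p ∤ [L^{H} : F]` when `p ∤ [L : F]` (tower law). [cite: Washington1997, §13.1] -/
private theorem not_dvd_finrank_fixedField' (L : Type) [Field L] [Algebra F L] [FiniteDimensional F L]
    (hp : ¬ p ∣ Module.finrank F L) (H : Subgroup (L ≃ₐ[F] L)) :
    ¬ p ∣ Module.finrank F ↥(fixedField H) := fun h =>
  hp (h.trans (Dvd.intro _ (Module.finrank_mul_finrank F ↥(fixedField H) L)))

/-- **μ-descent through a Klein four-group.**  `κ` a `ℤ_p`-extension of the number field `F`, `p ≠ 2`, `L/F` finite Galois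
with `κ ∘ res` onto, `u, v ∈ Gal(L/F)` commuting involutions with `u ≠ v`, `u, v ≠ 1`.  If the towers `L^{⟨u⟩}·F_∞`,
`L^{⟨v⟩}·F_∞`, `L^{⟨uv⟩}·F_∞` have `μ = 0` (growth form), then so does `L·F_∞/L` — the μ-descent
`classicalMuVanishes_restrict_of_normRelation` for the kernel-certified relation `2 = N_⟨u⟩ + N_⟨v⟩ − u N_⟨uv⟩`
(`NormRelation.normRelation_klein_four`, [BiasseEtAl2022] Example 2.5), `p ∤ 2`.  Under the growth fact
`iwasawa1959_classNumberPExp_growth`. [cite: BiasseEtAl2022, Example 2.5, Prop. 3.7] [cite: Washington1997, §13.1] -/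
theorem classicalMuVanishes_restrict_of_klein_four (hI : iwasawa1959_classNumberPExp_growth) (hp2 : p ≠ 2)
    (κ : ZpExtension F p) (L : Type) [Field L] [NumberField L] [Algebra F L] [IsGalois F L]
    (hL : Function.Surjective (κ.toContinuousMonoidHom.comp (absGaloisRestrict F L)))
    {u v : L ≃ₐ[F] L} (hu : u * u = 1) (hv : v * v = 1) (huv : u * v = v * u) (hu1 : u ≠ 1) (hv1 : v ≠ 1)
    (hne : u ≠ v)
    (hsu : Function.Surjective
      (κ.toContinuousMonoidHom.comp (absGaloisRestrict F ↥(fixedField (Subgroup.zpowers u)))))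
    (hsv : Function.Surjective
      (κ.toContinuousMonoidHom.comp (absGaloisRestrict F ↥(fixedField (Subgroup.zpowers v)))))
    (hsuv : Function.Surjective
      (κ.toContinuousMonoidHom.comp (absGaloisRestrict F ↥(fixedField (Subgroup.zpowers (u * v))))))
    (hμu : ClassicalMuVanishes (κ.restrict ↥(fixedField (Subgroup.zpowers u)) hsu))
    (hμv : ClassicalMuVanishes (κ.restrict ↥(fixedField (Subgroup.zpowers v)) hsv))
    (hμuv : ClassicalMuVanishes (κ.restrict ↥(fixedField (Subgroup.zpowers (u * v))) hsuv)) :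
    ClassicalMuVanishes (κ.restrict L hL) := by
  classical
  haveI : FiniteDimensional F L := Module.Finite.of_restrictScalars_finite ℚ F L
  have hpd : ¬ p ∣ 2 := fun h => hp2 ((Nat.prime_dvd_prime_iff_eq (Fact.out : p.Prime) Nat.prime_two).mp h)
  let Hs : Fin 3 → Subgroup (L ≃ₐ[F] L) :=
    ![Subgroup.zpowers u, Subgroup.zpowers v, Subgroup.zpowers (u * v)]
  have hH : ∀ i, Function.Surjective
      (κ.toContinuousMonoidHom.comp (absGaloisRestrict F ↥(fixedField (Hs i)))) := by
    intro i
    fin_cases i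
    · exact hsu
    · exact hsv
    · exact hsuv
  refine classicalMuVanishes_restrict_of_normRelation hI κ L hL Hs
    (![fun x => if x = 1 then (1 : ℤ) else 0, fun x => if x = 1 then (1 : ℤ) else 0,
      fun x => if x = u then (-1 : ℤ) else 0])
    (fun (_ : Fin 3) (y : L ≃ₐ[F] L) => if y = 1 then (1 : ℤ) else 0) hpd
    (NormRelation.normRelation_klein_four hu hv huv hu1 hv1 hne) hH ?_
  intro i
  fin_cases i
  · exact hμu
  · exact hμv
  · exact hμuv

/-- **Consumer form of the Klein descent (cyclotomic towers, one conjugate pair).**  `κ` the cyclotomic `ℤ_p`-extension of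
`F`, `p ≠ 2`, `L/F` finite Galois with `p ∤ [L : F]`, `u, v ∈ Gal(L/F)` commuting involutions, `u ≠ v`, `u, v ≠ 1`, and `uv`
conjugate to `v` (`g v g⁻¹ = uv`; so `L^{⟨uv⟩} ≅ L^{⟨v⟩}`).  If `μ = 0` holds for every cyclotomic `ℤ_p`-extension of
`L^{⟨u⟩}` and of `L^{⟨v⟩}`, then it holds for every cyclotomic `ℤ_p`-extension of `L`.
[cite: BiasseEtAl2022, Example 2.5, Prop. 3.7] [cite: Washington1997, §13.1] -/
theorem classicalMuVanishes_of_isCyclotomic_of_klein_four (hI : iwasawa1959_classNumberPExp_growth) (hp2 : p ≠ 2)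
    (κ : ZpExtension F p) (hκ : κ.IsCyclotomic) (L : Type) [Field L] [NumberField L] [Algebra F L] [IsGalois F L]
    (hp : ¬ p ∣ Module.finrank F L)
    {u v : L ≃ₐ[F] L} (hu : u * u = 1) (hv : v * v = 1) (huv : u * v = v * u) (hu1 : u ≠ 1) (hv1 : v ≠ 1)
    (hne : u ≠ v) (hconj : ∃ g : L ≃ₐ[F] L, g * v * g⁻¹ = u * v)
    (hμu : ∀ κE : ZpExtension ↥(fixedField (Subgroup.zpowers u)) p, κE.IsCyclotomic → ClassicalMuVanishes κE)
    (hμv : ∀ κE : ZpExtension ↥(fixedField (Subgroup.zpowers v)) p, κE.IsCyclotomic → ClassicalMuVanishes κE)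
    (κL : ZpExtension L p) (hκL : κL.IsCyclotomic) : ClassicalMuVanishes κL := by
  haveI : FiniteDimensional F L := Module.Finite.of_restrictScalars_finite ℚ F L
  have hL := surjective_comp_absGaloisRestrict_of_not_dvd_finrank κ L hp
  have hs : ∀ H : Subgroup (L ≃ₐ[F] L), Function.Surjective
      (κ.toContinuousMonoidHom.comp (absGaloisRestrict F ↥(fixedField H))) := fun H =>
    surjective_comp_absGaloisRestrict_of_not_dvd_finrank κ _ (not_dvd_finrank_fixedField' L hp H)
  -- `L^{⟨uv⟩} ≃ₐ[F] L^{⟨v⟩}` by conjugation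
  obtain ⟨g, hg⟩ := hconj
  have hmap : (Subgroup.zpowers v).map (MulAut.conj g).toMonoidHom = Subgroup.zpowers (u * v) := by
    rw [MonoidHom.map_zpowers]
    exact congrArg Subgroup.zpowers hg
  obtain ⟨φ⟩ := nonempty_algEquiv_fixedField_conj (F := F) (Subgroup.zpowers v) g
  have φ' : ↥(fixedField (Subgroup.zpowers v)) ≃ₐ[F] ↥(fixedField (Subgroup.zpowers (u * v))) :=
    φ.trans (IntermediateField.equivOfEq (congrArg fixedField hmap))
  have h1 : ClassicalMuVanishes (κ.restrict L hL) :=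
    classicalMuVanishes_restrict_of_klein_four hI hp2 κ L hL hu hv huv hu1 hv1 hne (hs _) (hs _) (hs _)
      (hμu _ (isCyclotomic_restrict κ hκ _ (hs _))) (hμv _ (isCyclotomic_restrict κ hκ _ (hs _)))
      ((classicalMuVanishes_restrict_iff_of_algEquiv κ φ' (hs _) (hs _)).mp
        (hμv _ (isCyclotomic_restrict κ hκ _ (hs _))))
  exact (classicalMuVanishes_iff_of_isCyclotomic _ _ (isCyclotomic_restrict κ hκ L hL) hκL).mp h1

/-- **The `D₄`-shape over `ℚ` (census form): `μ(L) = 0 ⟸ μ(L^{⟨v⟩}) = 0`, Ferrero–Washington and Iwasawa growth by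
name.**  `L/ℚ` finite Galois, `p` odd with `p ∤ [L : ℚ]`, `u, v ∈ Gal(L/ℚ)` commuting involutions, `u ≠ v`, `u, v ≠ 1`,
`uv` conjugate to `v`, and `⟨u⟩` containing every commutator (so `L^{⟨u⟩}/ℚ` is abelian:
`isAbelianGalois_fixedField_of_commutator_mem`).  Then under the two named facts `iwasawa1959_classNumberPExp_growth` and
`ferreroWashington1979_classicalMuVanishes`, «`μ = 0` for every cyclotomic `ℤ_p`-extension of `L^{⟨v⟩}`» implies «`μ = 0` for
every cyclotomic `ℤ_p`-extension of `L`».  For `L = ℚ(E[3])` with `Gal(L/ℚ) ≅ N_s(3) ≅ D₄ = ⟨r, s⟩`: `u = r² = −1`, `v = s`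
(`r s r⁻¹ = −s = uv`, `[D₄, D₄] = {1, r²}`), `L^{⟨s⟩} = ℚ(P)`. [cite: BiasseEtAl2022, Example 2.5, Prop. 3.7]
[cite: Washington1997, §13.1, §7.5] -/
theorem classicalMuVanishes_of_isCyclotomic_of_klein_four_rat (hI : iwasawa1959_classNumberPExp_growth)
    (hFW : ferreroWashington1979_classicalMuVanishes) (hp2 : p ≠ 2)
    (L : Type) [Field L] [NumberField L] [IsGalois ℚ L] (hp : ¬ p ∣ Module.finrank ℚ L)
    {u v : L ≃ₐ[ℚ] L} (hu : u * u = 1) (hv : v * v = 1) (huv : u * v = v * u) (hu1 : u ≠ 1) (hv1 : v ≠ 1)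
    (hne : u ≠ v) (hconj : ∃ g : L ≃ₐ[ℚ] L, g * v * g⁻¹ = u * v)
    (hcomm : ∀ a b : L ≃ₐ[ℚ] L, a * b * a⁻¹ * b⁻¹ ∈ Subgroup.zpowers u)
    (hμv : ∀ κE : ZpExtension ↥(fixedField (Subgroup.zpowers v)) p, κE.IsCyclotomic → ClassicalMuVanishes κE)
    (κL : ZpExtension L p) (hκL : κL.IsCyclotomic) : ClassicalMuVanishes κL := by
  obtain ⟨κ, hκ⟩ := exists_cyclotomicZpExtension_holds ℚ p
  -- `⟨u⟩` is normal (it contains the commutators) and `L^{⟨u⟩}/ℚ` is abelian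
  haveI hN : (Subgroup.zpowers u).Normal := by
    refine ⟨fun h hh a => ?_⟩
    have h1 : a * h * a⁻¹ * h⁻¹ ∈ Subgroup.zpowers u := hcomm a h
    have h2 : a * h * a⁻¹ = (a * h * a⁻¹ * h⁻¹) * h := by group
    rw [h2]
    exact Subgroup.mul_mem _ h1 hh
  haveI : IsAbelianGalois ℚ ↥(fixedField (Subgroup.zpowers u)) :=
    isAbelianGalois_fixedField_of_commutator_mem (Subgroup.zpowers u) hcomm
  exact classicalMuVanishes_of_isCyclotomic_of_klein_four hI hp2 κ hκ L hp hu hv huv hu1 hv1 hne hconj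
    (fun κE hκE => hFW _ p κE hκE) hμv κL hκL

end Literature.NumberTheory.IwasawaTheory

end
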